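import Summits.BirchSwinnertonDyer.BirchSwinnertonDyer.Theorems.AlignedTransportAtTwoMainConjectureOfRankZeroBSDAtTwoSexticNormRelationDescentSignFree
import Literature.NumberTheory.EllipticCurves.ZpExtensionRestrictTwoSqrtTwoAnyDegree
import HarnessLib

/-!
# Route `AlignedTransportAtTwo`, crux C2 `MainConjectureOfRankZeroBSDAtTwo` (stmt-BirchSwinnertonDyer-22298):
# THE PFμ⁺ CARRIER `ℚ(W[2], √−1)` MEETS `ℚ_∞` TRIVIALLY — `√2 ∉ ℚ(W[2], √−1)` from `±2Δ_W ∉ ℚ²`, hence `κ ∘ res` is onto `Γ_{ℚ(W[2], √−1)}`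
# (degree `12`, both signs of `Δ_W`; automatic on the crux's domain)

Sequel of `…SexticNormRelationDescentSignFree` (same seat bsd-line-att-p4 g29) and of this seat's Literature file `ZpExtensionRestrictTwoSqrtTwoAnyDegree`
(the degree-free criterion «`√2 ∉ L ⟹ κ ∘ res_{ℚ,L}` onto»). HONEST FRAMING: WIDTH-5 attached prover seat on line `birth` of the lead `bsd-line-att-p2`;
`--supports` stmt-BirchSwinnertonDyer-22298, closes nothing; BSD is NOT proved; crux C2, its verdict «blocked-on `Rank1Residual.GreenbergMuConjectureIrreducible`»
and every registered stub untouched. THEOREMS ONLY.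

WHY. The registered stub PFμ⁺ (`PointFieldMuCycAtTwo`) quantifies over the cyclotomic `ℤ₂`-extensions of `L = ℚ(W[2]) ⊔ ℚ⟮i⟯` (`i² = −1`), a field of degree
`12`; every kernel manipulation of its towers (restriction of `ℚ`'s cyclotomic `ℤ₂`-extension, Iwasawa's ascent/descent along `L/ℚ(W[2])`) needs
`L ∩ ℚ_∞ = ℚ`, i.e. `√2 ∉ L`, and the tree's criterion required `4 ∤ [L:ℚ]`. Here:

* §1 `mem_range_or_exists_sq_eq_mul` (part A's quadratic-extension lemma with `2` replaced by any `r ∈ F`: `x² = r` in `L = F ⊕ F·d`, `d² = m` ⟹ `x ∈ F`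
  or `r·m ∈ F²`) and ★ `forall_sq_ne_ratCast_divisionField_two`: **`√r ∉ ℚ(W[2])` for every rational `r` with `r ∉ ℚ²`, `rΔ_W ∉ ℚ²`** (`E[2]` irreducible,
  `Δ_W ∉ ℚ²`) — the unique quadratic subfield of the `S₃`-sextic is `ℚ(√Δ_W)`.
* §2 `exists_add_mul_of_mem_sup_adjoin`: every element of `ℚ(W[2]) ⊔ ℚ⟮i⟯` is `a + b·i` with `a, b ∈ ℚ(W[2])`; ★★ `forall_sq_ne_two_sup_adjoin_I`:
  **`√2 ∉ ℚ(W[2], i)`** provided `Δ_W, 2Δ_W, −2Δ_W ∉ ℚ²` (`(a+bi)² = 2` forces `ab = 0`, then `√2 ∈ ℚ(W[2])` or `√−2 ∈ ℚ(W[2])`); ★★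
  `surjective_gal_restrict_sup_adjoin_I`: `κ ∘ res` is ONTO `Γ_{ℚ(W[2], i)}` for the cyclotomic `κ` of `ℚ` (this seat's degree-free criterion).
* §3 on C2's binders (`W` globally minimal, good ordinary at `2`): `−2Δ_W ∉ ℚ²` as well (`Δ_min` odd), so the surjectivity holds on the crux's ENTIRE domain
  (`surjective_gal_restrict_sup_adjoin_I_of_isOrdinaryAt`).

References: [Washington1997] §13.1; [SilvermanAEC2009] III.§1, VII.5 Prop. 5.1(a); tree: part A, `ZpExtensionRestrictTwoSqrtTwoAnyDegree` (this seat).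
-/

set_option linter.dupNamespace false
set_option autoImplicit false

noncomputable section

open scoped Classical NumberField

namespace Summit.BirchSwinnertonDyer.BirchSwinnertonDyer.Theorems.AlignedTransportAtTwoSexticNormRelationDescentSignFreeAdjoinI

open NumberField Polynomial WeierstrassCurve IntermediateField Field
  Literature.NumberTheory.EllipticCurves Literature.NumberTheory.EllipticCurves.Greenberg1999
  Literature.NumberTheory.EllipticCurves.DokchitserDokchitser2012
  Literature.NumberTheory.EllipticCurves.ZpExtension Literature.NumberTheory.GaloisRepresentations
  Literature.NumberTheory.IwasawaTheory Literature.NumberTheory.NumberFields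
  Summit.BirchSwinnertonDyer.BirchSwinnertonDyer.Theorems.AlignedTransportAtTwoFineRoad.DivisionCubic
  Summit.BirchSwinnertonDyer.BirchSwinnertonDyer.Theorems.AlignedTransportAtTwoFineRoad.TowerImageDelta
  Summit.BirchSwinnertonDyer.BirchSwinnertonDyer.Theorems.AlignedTransportAtTwoCubicClosureParity
  Summit.BirchSwinnertonDyer.BirchSwinnertonDyer.Theorems.AlignedTransportAtTwoSexticTowerGrowth
  Summit.BirchSwinnertonDyer.BirchSwinnertonDyer.Theorems.AlignedTransportAtTwoSexticNormRelationDescent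
  Summit.BirchSwinnertonDyer.BirchSwinnertonDyer.Theorems.AlignedTransportAtTwoSexticNormRelationDescentMu
  Summit.BirchSwinnertonDyer.BirchSwinnertonDyer.Theorems.AlignedTransportAtTwoSexticNormRelationDescentSignFree

variable (W : WeierstrassCurve ℚ) [W.IsElliptic]

/-! ## §1 `√r ∉ ℚ(W[2])` unless `r ∈ ℚ²` or `rΔ_W ∈ ℚ²` -/

omit [W.IsElliptic] in
/-- **Quadratic-extension lemma, general radicand.** `L ⊇ F` fields of characteristic `0`, `[L : F] = 2`, `d ∈ L ∖ F`, `d² = m ∈ F`, `r ∈ F`. If `x ∈ L` has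
`x² = r` then `x ∈ F` or `r·m` is a square in `F` (`x = a + b·d`: `2ab = 0`; `b = 0` gives `x ∈ F`, `a = 0` gives `b²m = r`, `(bm)² = rm`). [folklore] -/
theorem mem_range_or_exists_sq_eq_mul {F L : Type*} [Field F] [Field L] [Algebra F L] [CharZero L]
    (h2 : Module.finrank F L = 2) {d : L} {m : F} (hd : d ^ 2 = algebraMap F L m) (hdF : d ∉ Set.range (algebraMap F L))
    (r : F) {x : L} (hx : x ^ 2 = algebraMap F L r) : x ∈ Set.range (algebraMap F L) ∨ ∃ c : F, c ^ 2 = r * m := by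
  have hli : LinearIndependent F ![(1 : L), d] := by
    rw [LinearIndependent.pair_iff]
    intro s t hst
    rw [Algebra.smul_def, Algebra.smul_def, mul_one] at hst
    by_cases ht : t = 0
    · refine ⟨?_, ht⟩
      rw [ht, map_zero, zero_mul, add_zero] at hst
      exact (map_eq_zero_iff _ (algebraMap F L).injective).mp hst
    · exfalso
      apply hdF
      refine ⟨-s / t, ?_⟩
      have htL : algebraMap F L t ≠ 0 := (map_ne_zero_iff _ (algebraMap F L).injective).mpr ht
      rw [map_div₀, map_neg, div_eq_iff htL]
      linear_combination -hst
  have hspan := hli.span_eq_top_of_card_eq_finrank (by rw [Fintype.card_fin, h2])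
  rw [Matrix.range_cons_cons_empty] at hspan
  have hxmem : x ∈ Submodule.span F ({(1 : L), d} : Set L) := by rw [hspan]; exact Submodule.mem_top
  obtain ⟨a, b, hab⟩ := Submodule.mem_span_pair.mp hxmem
  rw [Algebra.smul_def, Algebra.smul_def, mul_one] at hab
  have key : (a ^ 2 + b ^ 2 * m - r) • (1 : L) + (2 * a * b) • d = 0 := by
    rw [Algebra.smul_def, Algebra.smul_def, mul_one]
    simp only [map_sub, map_add, map_mul, map_pow, map_ofNat]
    rw [← hab] at hx
    linear_combination hx - (algebraMap F L b) ^ 2 * hd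
  obtain ⟨h1, hab0⟩ := (LinearIndependent.pair_iff.mp hli) _ _ key
  have hab0' : algebraMap F L a = 0 ∨ algebraMap F L b = 0 := by
    have h := congrArg (algebraMap F L) hab0
    rw [map_mul, map_mul, map_ofNat, map_zero] at h
    rcases mul_eq_zero.mp h with h' | h'
    · rcases mul_eq_zero.mp h' with h'' | h''
      · exact absurd h'' two_ne_zero
      · exact Or.inl h''
    · exact Or.inr h'
  rcases hab0' with ha | hb
  · right
    have ha' : a = 0 := (map_eq_zero_iff _ (algebraMap F L).injective).mp ha
    refine ⟨b * m, ?_⟩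
    rw [ha'] at h1
    have hbm : b ^ 2 * m = r := by linear_combination h1
    linear_combination m * hbm
  · left
    exact ⟨a, by rw [← hab, hb, zero_mul, add_zero]⟩

/-- ★ **`√r ∉ ℚ(W[2])` for every rational `r` with `r ∉ ℚ²` and `rΔ_W ∉ ℚ²`** (`W/ℚ` elliptic, no rational `2`-torsion abscissa, `Δ_W ∉ ℚ²`): over the cubic
field `F = ℚ(β₀)` (`T = F(δ)`, `[T:F] = 2`), `x² = r` gives `√r ∈ F` or `√(rΔ_W) ∈ F`, a quadratic subfield of a cubic field. The case `r = 2` is part A's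
`forall_sq_ne_two_divisionField_two`; `r = −1` says `i ∉ ℚ(W[2])` unless `−Δ_W ∈ ℚ²`; `r = −2` is used in §2. [cite: SilvermanAEC2009, III.§1] [cite: Washington1997, §13.1] -/
theorem forall_sq_ne_ratCast_divisionField_two (ht : ∀ x : ℚ, ¬ HasRationalTwoTorsionX W x) (hsq : ¬ IsSquare W.Δ)
    (r : ℚ) (hr : ¬ IsSquare r) (hrΔ : ¬ IsSquare (r * W.Δ)) :
    ∀ x : W.divisionField 2, x ^ 2 ≠ (r : W.divisionField 2) := by
  intro x hx
  haveI : IsGalois ℚ (W.divisionField 2) := W.isGalois_divisionField 2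
  set E := ℚ⟮(⟨xT W two_ne_zero 0, xT_mem W 0⟩ : W.divisionField 2)⟯ with hEdef
  set d : W.divisionField 2 := ⟨4 * delta W two_ne_zero, (delta_mem_and_sq W).1⟩ with hddef
  have hE3 : Module.finrank ℚ E = 3 := finrank_adjoin_xT W ht 0
  have htower := Module.finrank_mul_finrank ℚ E (W.divisionField 2)
  rw [hE3, finrank_divisionField_two_eq_six W ht hsq] at htower
  have hTE : Module.finrank E (W.divisionField 2) = 2 := by omega
  have hdT : d ^ 2 = ((W.Δ : ℚ) : W.divisionField 2) := by
    apply (algebraMap (W.divisionField 2) (AlgebraicClosure ℚ)).injective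
    rw [map_pow, map_ratCast]
    exact (delta_mem_and_sq W).2
  have hd : d ^ 2 = algebraMap E (W.divisionField 2) ((W.Δ : ℚ) : E) := by rw [map_ratCast]; exact hdT
  have hdE : d ∉ Set.range (algebraMap E (W.divisionField 2)) := by
    rintro ⟨e, he⟩
    apply delta_not_mem_adjoin_xT_of_not_isSquare W ht hsq 0
    change d ∈ E
    rw [← he]
    exact e.2
  have hnoquad : ∀ (y : W.divisionField 2) (q : ℚ), y ^ 2 = (q : W.divisionField 2) → ¬ IsSquare q → y ∈ E → False := by
    intro y q hy hq hyE
    have hle : ℚ⟮y⟯ ≤ E := adjoin_simple_le_iff.mpr hyE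
    have hdvd := IntermediateField.finrank_dvd_of_le_right hle
    rw [finrank_adjoin_eq_two_of_sq_eq hy hq, hE3] at hdvd
    omega
  have hx' : x ^ 2 = algebraMap E (W.divisionField 2) ((r : ℚ) : E) := by rw [map_ratCast]; exact hx
  rcases mem_range_or_exists_sq_eq_mul hTE hd hdE ((r : ℚ) : E) hx' with ⟨e, he⟩ | ⟨c, hc⟩
  · exact hnoquad x r hx hr (by rw [← he]; exact e.2)
  · refine hnoquad (c : W.divisionField 2) (r * W.Δ) ?_ hrΔ c.2
    have h := congrArg (algebraMap E (W.divisionField 2)) hc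
    rw [map_pow, map_mul, map_ratCast, map_ratCast] at h
    rw [Rat.cast_mul]
    exact h

/-! ## §2 The field `ℚ(W[2]) ⊔ ℚ⟮i⟯`: elements, `√2`, and `κ ∘ res` -/

omit [W.IsElliptic] in
/-- **Every element of `ℚ(W[2]) ⊔ ℚ⟮i⟯` is `a + b·i` with `a, b ∈ ℚ(W[2])`** (`i² = −1`): the set of such elements is a `ℚ`-subalgebra of `ℚ̄` containing
`ℚ(W[2])` and `i`, and `ℚ⟮i⟯`, `ℚ(W[2]) ⊔ ℚ⟮i⟯` are generated as subalgebras (algebraic elements). [cite: MilneFT2022, Ch. 3] -/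
theorem exists_add_mul_of_mem_sup_adjoin {i : AlgebraicClosure ℚ} (hi : i ^ 2 = -1) {y : AlgebraicClosure ℚ}
    (hy : y ∈ W.divisionField 2 ⊔ IntermediateField.adjoin ℚ ({i} : Set (AlgebraicClosure ℚ))) :
    ∃ a ∈ W.divisionField 2, ∃ b ∈ W.divisionField 2, y = a + b * i := by
  set T : IntermediateField ℚ (AlgebraicClosure ℚ) := W.divisionField 2 with hT
  set Qi : IntermediateField ℚ (AlgebraicClosure ℚ) := IntermediateField.adjoin ℚ ({i} : Set (AlgebraicClosure ℚ)) with hQi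
  have hint : IsIntegral ℚ i := by
    refine ⟨X ^ 2 + 1, monic_X_pow_add_C _ two_ne_zero, ?_⟩
    simp [hi]
  haveI : FiniteDimensional ℚ ↥Qi := IntermediateField.adjoin.finiteDimensional hint
  let S : Subalgebra ℚ (AlgebraicClosure ℚ) :=
    { carrier := {w | ∃ a ∈ T, ∃ b ∈ T, w = a + b * i}
      mul_mem' := by
        rintro u v ⟨a, ha, b, hb, rfl⟩ ⟨c, hc, e, he, rfl⟩
        refine ⟨a * c - b * e, sub_mem (mul_mem ha hc) (mul_mem hb he), a * e + b * c, add_mem (mul_mem ha he) (mul_mem hb hc), ?_⟩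
        linear_combination (b * e) * hi
      one_mem' := ⟨1, one_mem _, 0, zero_mem _, by ring⟩
      add_mem' := by
        rintro u v ⟨a, ha, b, hb, rfl⟩ ⟨c, hc, e, he, rfl⟩
        exact ⟨a + c, add_mem ha hc, b + e, add_mem hb he, by ring⟩
      zero_mem' := ⟨0, zero_mem _, 0, zero_mem _, by ring⟩
      algebraMap_mem' := fun t ↦ ⟨algebraMap ℚ _ t, IntermediateField.algebraMap_mem T t, 0, zero_mem _, by ring⟩ }
  have hTS : T.toSubalgebra ≤ S := fun w hw ↦ ⟨w, hw, 0, zero_mem _, by ring⟩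
  have hiS : i ∈ S := ⟨0, zero_mem _, 1, one_mem _, by ring⟩
  have hQiS : Qi.toSubalgebra ≤ S := by
    rw [hQi, IntermediateField.adjoin_simple_toSubalgebra_of_isAlgebraic hint.isAlgebraic]
    exact Algebra.adjoin_le (Set.singleton_subset_iff.mpr hiS)
  have hK'S : (T ⊔ Qi).toSubalgebra ≤ S := by
    haveI : Algebra.IsAlgebraic ℚ ↥Qi := Algebra.IsAlgebraic.of_finite ℚ ↥Qi
    rw [IntermediateField.sup_toSubalgebra_of_isAlgebraic_right]
    exact sup_le hTS hQiS
  obtain ⟨a, ha, b, hb, h⟩ := hK'S hy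
  exact ⟨a, ha, b, hb, h⟩

/-- ★★ **`√2 ∉ ℚ(W[2], √−1)`** for `W/ℚ` elliptic with no rational `2`-torsion abscissa and `Δ_W, 2Δ_W, −2Δ_W ∉ ℚ²` (`i² = −1`): an element `a + b·i` of
square `2` (`a, b ∈ ℚ(W[2])`) has `2ab·i = 2 − a² + b² ∈ ℚ(W[2])`, so `ab = 0` unless `i ∈ ℚ(W[2])` (then `a + bi ∈ ℚ(W[2])` outright); `b = 0` puts `√2`,
`a = 0` puts `√−2` in `ℚ(W[2])` — excluded by §1 / part A. [cite: Washington1997, §13.1] [cite: SilvermanAEC2009, III.§1] -/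
theorem forall_sq_ne_two_sup_adjoin_I (ht : ∀ x : ℚ, ¬ HasRationalTwoTorsionX W x) (hsq : ¬ IsSquare W.Δ) (h2Δ : ¬ IsSquare (2 * W.Δ))
    (hm2Δ : ¬ IsSquare (-2 * W.Δ)) {i : AlgebraicClosure ℚ} (hi : i ^ 2 = -1) :
    ∀ x : ↥(W.divisionField 2 ⊔ IntermediateField.adjoin ℚ ({i} : Set (AlgebraicClosure ℚ))), x ^ 2 ≠ 2 := by
  intro x hx
  have hx' : (x : AlgebraicClosure ℚ) ^ 2 = 2 := by
    have := congrArg (fun z : ↥(W.divisionField 2 ⊔ IntermediateField.adjoin ℚ ({i} : Set (AlgebraicClosure ℚ))) ↦ (z : AlgebraicClosure ℚ)) hx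
    push_cast at this
    exact this
  obtain ⟨a, ha, b, hb, hab⟩ := exists_add_mul_of_mem_sup_adjoin W hi x.2
  -- no element of `T = ℚ(W[2])` has square `2` or `−2`
  have hT2 : ∀ z ∈ W.divisionField 2, z ^ 2 ≠ 2 := fun z hz h ↦
    forall_sq_ne_two_divisionField_two W ht hsq h2Δ ⟨z, hz⟩ (Subtype.ext (by push_cast; exact h))
  have hTm2 : ∀ z ∈ W.divisionField 2, z ^ 2 ≠ -2 := by
    intro z hz h
    have h2sq : ¬ IsSquare (-2 : ℚ) := fun ⟨r, hr⟩ ↦ by nlinarith [mul_self_nonneg r]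
    refine forall_sq_ne_ratCast_divisionField_two W ht hsq (-2) h2sq hm2Δ ⟨z, hz⟩ (Subtype.ext ?_)
    push_cast
    exact h
  -- `(a + bi)² = 2`: `(a² − b² − 2) + (2ab)·i = 0`
  have key : (a ^ 2 - b ^ 2 - 2) + (2 * a * b) * i = 0 := by
    rw [hab] at hx'
    linear_combination hx' - b ^ 2 * hi
  by_cases hab0 : a * b = 0
  · rcases mul_eq_zero.mp hab0 with ha0 | hb0
    · -- `x = b i`, `x² = −b² = 2`: `b² = −2`
      apply hTm2 b hb
      have : b ^ 2 * i ^ 2 = 2 := by rw [hab, ha0] at hx'; linear_combination hx'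
      rw [hi] at this
      linear_combination -this
    · -- `x = a ∈ T`
      apply hT2 a ha
      rw [hab, hb0] at hx'
      linear_combination hx'
  · -- `2ab ≠ 0`: then `i = −(a² − b² − 2)/(2ab) ∈ T`, so `x ∈ T`
    have h2ab : (2 * a * b : AlgebraicClosure ℚ) ≠ 0 := by
      intro h; apply hab0
      have : (2 : AlgebraicClosure ℚ) * (a * b) = 0 := by rw [← mul_assoc]; exact h
      exact (mul_eq_zero.mp this).resolve_left two_ne_zero
    have hiT : i ∈ W.divisionField 2 := by
      have hi_eq : i = -(a ^ 2 - b ^ 2 - 2) / (2 * a * b) := by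
        rw [eq_div_iff h2ab]
        linear_combination key
      rw [hi_eq]
      exact div_mem (neg_mem (sub_mem (sub_mem (pow_mem ha 2) (pow_mem hb 2)) (ofNat_mem _ 2)))
        (mul_mem (mul_mem (ofNat_mem _ 2) ha) hb)
    exact hT2 (a + b * i) (add_mem ha (mul_mem hb hiT)) (by rw [← hab]; exact hx')

/-- ★★ **`κ ∘ res : Γ_{ℚ(W[2], √−1)} → ℤ₂` is ONTO** (`κ` the cyclotomic `ℤ₂`-extension of `ℚ`; `W` with no rational `2`-torsion abscissa,
`Δ_W, 2Δ_W, −2Δ_W ∉ ℚ²`; BOTH signs of `Δ_W`): `√2 ∉ ℚ(W[2], i)` and this seat's degree-free criterion. So `κ.restrict` is the cyclotomic `ℤ₂`-extension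
of the PFμ⁺ carrier, with layers `ℚ(W[2], i)·ℚ_n`. [cite: Washington1997, §13.1] -/
theorem surjective_gal_restrict_sup_adjoin_I (ht : ∀ x : ℚ, ¬ HasRationalTwoTorsionX W x) (hsq : ¬ IsSquare W.Δ) (h2Δ : ¬ IsSquare (2 * W.Δ))
    (hm2Δ : ¬ IsSquare (-2 * W.Δ)) {i : AlgebraicClosure ℚ} (hi : i ^ 2 = -1) (κ : ZpExtension ℚ 2) (hκ : κ.IsCyclotomic)
    [NumberField ↥(W.divisionField 2 ⊔ IntermediateField.adjoin ℚ ({i} : Set (AlgebraicClosure ℚ)))] :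
    Function.Surjective (κ.toContinuousMonoidHom.comp
      (absGaloisRestrict ℚ ↥(W.divisionField 2 ⊔ IntermediateField.adjoin ℚ ({i} : Set (AlgebraicClosure ℚ))))) :=
  surjective_comp_absGaloisRestrict_of_forall_sq_ne_two' κ _ hκ (forall_sq_ne_two_sup_adjoin_I W ht hsq h2Δ hm2Δ hi)

/-- `ℚ(W[2]) ⊔ ℚ⟮i⟯` is a number field (finite over `ℚ`). [cite: MilneFT2022, Ch. 3] -/
theorem numberField_sup_adjoin_I {i : AlgebraicClosure ℚ} (hi : i ^ 2 = -1) :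
    NumberField ↥(W.divisionField 2 ⊔ IntermediateField.adjoin ℚ ({i} : Set (AlgebraicClosure ℚ))) := by
  have hint : IsIntegral ℚ i := by
    refine ⟨X ^ 2 + 1, monic_X_pow_add_C _ two_ne_zero, ?_⟩
    simp [hi]
  have hfd : FiniteDimensional ℚ ↥(W.divisionField 2 ⊔ IntermediateField.adjoin ℚ ({i} : Set (AlgebraicClosure ℚ))) :=
    @IntermediateField.finiteDimensional_sup ℚ (AlgebraicClosure ℚ) _ _ _ (W.divisionField 2)
      (IntermediateField.adjoin ℚ ({i} : Set (AlgebraicClosure ℚ))) inferInstance (IntermediateField.adjoin.finiteDimensional hint)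
  exact @NumberField.mk _ _ inferInstance hfd

/-! ## §3 On C2's binders -/

omit [W.IsElliptic] in
/-- **`−2Δ_W ∉ ℚ²` on C2's domain** (`W` globally minimal, good ordinary at `2`: `Δ_W = Δ_min` odd, `−2·odd ≡ 2, 6 (mod 8)`). [cite: SilvermanAEC2009, VII.5 Prop. 5.1(a)] -/
theorem not_isSquare_neg_two_mul_Δ_of_isOrdinaryAt [W.IsGloballyMinimal] (hord : IsOrdinaryAt W 2) : ¬ IsSquare (-2 * W.Δ) := by
  haveI : Fact (Nat.Prime 2) := ⟨Nat.prime_two⟩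
  have hodd : ¬ (2 : ℤ) ∣ minimalDiscriminantInt W :=
    fun h ↦ W.not_hasGoodReductionAtPrime_of_dvd_minimalDiscriminantInt 2 (by exact_mod_cast h) hord.1
  rw [← cast_minimalDiscriminantInt W, show (-2 : ℚ) * (minimalDiscriminantInt W : ℚ) = ((-2 * minimalDiscriminantInt W : ℤ) : ℚ) by push_cast; ring,
    Rat.isSquare_intCast_iff]
  intro hsq
  rcases emod_eight_of_isSquare hsq with h | h | h <;> omega

/-- ★ **On the crux's domain** (`W` globally minimal, good ordinary at `2`, no rational `2`-torsion abscissa, `Δ_W ∉ ℚ²`; BOTH signs of `Δ_W`):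
`√2 ∉ ℚ(W[2], √−1)` and **`κ ∘ res` is onto `Γ_{ℚ(W[2], √−1)}`** — the PFμ⁺ carrier meets `ℚ_∞` in `ℚ`. [cite: Washington1997, §13.1] -/
theorem surjective_gal_restrict_sup_adjoin_I_of_isOrdinaryAt [W.IsGloballyMinimal] (hord : IsOrdinaryAt W 2)
    (ht : ∀ x : ℚ, ¬ HasRationalTwoTorsionX W x) (hsq : ¬ IsSquare W.Δ) {i : AlgebraicClosure ℚ} (hi : i ^ 2 = -1)
    (κ : ZpExtension ℚ 2) (hκ : κ.IsCyclotomic)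
    [NumberField ↥(W.divisionField 2 ⊔ IntermediateField.adjoin ℚ ({i} : Set (AlgebraicClosure ℚ)))] :
    Function.Surjective (κ.toContinuousMonoidHom.comp
      (absGaloisRestrict ℚ ↥(W.divisionField 2 ⊔ IntermediateField.adjoin ℚ ({i} : Set (AlgebraicClosure ℚ))))) :=
  surjective_gal_restrict_sup_adjoin_I W ht hsq (not_isSquare_two_mul_Δ_of_isOrdinaryAt W hord)
    (not_isSquare_neg_two_mul_Δ_of_isOrdinaryAt W hord) hi κ hκ

end Summit.BirchSwinnertonDyer.BirchSwinnertonDyer.Theorems.AlignedTransportAtTwoSexticNormRelationDescentSignFreeAdjoinI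

end
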